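import Literature.NumberTheory.EllipticCurves.Kato2004.IwasawaH1ReductionTowerPk
import Literature.NumberTheory.EllipticCurves.CMTorsionIrreducibleOrdinaryProofs
import Literature.NumberTheory.GaloisRepresentations.LocalKummerTorsion
import Literature.NumberTheory.GaloisRepresentations.LocalDualityDescent
import Literature.NumberTheory.EllipticCurves.Rank1Residual.GVParityTwistProofs
import HarnessLib

set_option autoImplicit false

-- the summit and its single problem are both named `BirchSwinnertonDyer` (registry layout D-0017)
set_option linter.dupNamespace false

/-!
# Stub `stub_reciprocityPkX9` (hG34ᵍ) of line `graded_euler_loss`, crux `KatoDivisibilityX9`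
# (stmt-BirchSwinnertonDyer-20547): the PAIRING BRIDGE `E[p^{d+1}] × E[p] → μ_{p^{d+1}}` — a level-`p^{d+1}`
# alternating pairing restricted along `E[p] ⊂ E[p^{d+1}]` descends through `P ↦ p^d P` to a UNIT multiple of any
# non-degenerate alternating pairing on `E[p]`

Seat `bsd-line-k6-p4` (prover-bsd-line-k6-p4-g5-0, stub worker for `stub_reciprocityPkX9`).  THEOREMS ONLY, sorry-free;
no definition, no named fact, nothing asserted about any particular curve.  `--supports stmt-BirchSwinnertonDyer-20547
--as helper`.  WHERE IT SITS (MEMO-es §15 STEP 4, «⟨p^d t', Y⟩ = ⟨t', p^d Y⟩ = ι(T^e⟨t̄', ȳ⟩)»): the level-`p^{d+1}`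
reciprocity is an identity for a `μ_{p^{d+1}}`-valued pairing `e_k` on `E[p^{d+1}]`, the stub's conclusion is stated for
`weilPairingHom W p eW` of an ARBITRARY non-degenerate alternating `eW` on `E[p]`, and the tree knows Weil pairings only
level by level; the bridge is derived here for abstract biadditive pairings:
* §1 `surjective_geomTorsionPowToModP` — over `ℚ`, `P ↦ p^d P : E[p^{d+1}] → E[p]` is onto (counting, `#E[n] = n²`).
* §2 `apply_eq_zero_of_geomTorsionPowToModP_eq_zero` (`e_k(P, ιQ) = 0` if `p^d P = 0`), `exists_descent` (a biadditive
  `ē` on `E[p]` with `e_k(P, ιQ) = incl(ē(p^d P, Q))`, alternating / right-non-degenerate when `e_k` is).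
* §3 `closure_pair_eq_top`, `eq_zsmul_of_apply_eq_zsmul`, `exists_int_not_dvd_eq_zsmul_of_alternating` — two alternating
  biadditive `μ_p`-valued pairings on `E[p]`, the first right-non-degenerate, are proportional (`ē = c • e₁`), with `p ∤ c`
  when `ē` is right-non-degenerate too.
* §4 **`exists_unit_descent`**: `e_k(P, ιQ) = incl(c • e₁(p^d P, Q))` with `p ∤ c` (Silverman III.8.1 (e) up to a unit).

HONEST LABEL: bookkeeping; the stub `stub_reciprocityPkX9` stays OPEN; crux 20547 / B2 untouched; BSD is not advanced.
References: J. H. Silverman, AEC (2009) III.8.1, III.6.4 (b) [SilvermanAEC2009]; B. Mazur, K. Rubin, Mem. AMS 799 (2004)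
§1.3 [MazurRubin2004]; HOME/MEMO-es.md §15 STEP 4.
-/

noncomputable section

open scoped Classical
open Field WeierstrassCurve
open Literature.NumberTheory.GaloisRepresentations
open Literature.NumberTheory.GaloisRepresentations.DiscreteGaloisModule (MuCarrier)
open Literature.NumberTheory.EllipticCurves

namespace Summit.BirchSwinnertonDyer.BirchSwinnertonDyer.Theorems.OneSidedTwistSqueezeX9KatoDivisibilityX9StubReciprocityPkX9Pairing

variable (W : WeierstrassCurve ℚ) [W.IsElliptic] (p : ℕ) [Fact p.Prime] (d : ℕ)

/-! ## §1 `P ↦ p^d P : E[p^{d+1}] → E[p]` is onto -/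

/-- `#E[(p:ℤ)^m] = p^{2m}` over `ℚ` (the tree's `#E[n] = n²` in the spelling `(p : ℤ) ^ m`).
[cite: SilvermanAEC2009, Cor. III.6.4(b)] -/
theorem natCard_geomTorsion_pow (m : ℕ) : Nat.card (geomTorsion W ((p : ℤ) ^ m)) = p ^ (2 * m) := by
  have h := W.natCard_geomTorsion_natCast (n := p ^ m) (pow_ne_zero m (Fact.out : p.Prime).ne_zero)
  rw [Nat.cast_pow] at h
  rw [h, ← pow_mul, mul_comm]

/-- `E[(p:ℤ)^m]` is finite. [cite: SilvermanAEC2009, Cor. III.6.4] -/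
theorem finite_geomTorsion_pow (m : ℕ) : Finite (geomTorsion W ((p : ℤ) ^ m)) :=
  Nat.finite_of_card_ne_zero (by rw [natCard_geomTorsion_pow W p m]; exact pow_ne_zero _ (Fact.out : p.Prime).ne_zero)

/-- `E[p]` is finite. [cite: SilvermanAEC2009, Cor. III.6.4] -/
theorem finite_geomTorsion_prime : Finite (geomTorsion W (p : ℤ)) := by
  have h := finite_geomTorsion_pow W p 1
  rwa [pow_one] at h

/-- **`E[p^{d+1}] → E[p]`, `P ↦ p^d P`, is surjective** (over `ℚ`): its kernel embeds in `E[p^d]` (`p^{2d}` elements),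
so its image has at least `p^{2(d+1)}/p^{2d} = p² = #E[p]` elements. [cite: SilvermanAEC2009, Cor. III.6.4(b)] -/
theorem surjective_geomTorsionPowToModP : Function.Surjective (W.geomTorsionPowToModP p d) := by
  have hp : p.Prime := Fact.out
  haveI := finite_geomTorsion_pow W p (d + 1)
  haveI := finite_geomTorsion_prime W p
  set f := W.geomTorsionPowToModP p d with hf
  have hker : Nat.card f.ker ≤ p ^ (2 * d) := by
    haveI := finite_geomTorsion_pow W p d
    rw [← natCard_geomTorsion_pow W p d]
    refine Nat.card_le_card_of_injective
      (fun P : f.ker => (⟨((P : geomTorsion W ((p : ℤ) ^ (d + 1))) : geomPoints W), ?_⟩ :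
        geomTorsion W ((p : ℤ) ^ d))) ?_
    · have hP : f P = 0 := (AddMonoidHom.mem_ker).mp P.2
      have hP' := congrArg (fun Q : geomTorsion W (p : ℤ) => (Q : geomPoints W)) hP
      simp only [hf, coe_geomTorsionPowToModP, ZeroMemClass.coe_zero] at hP'
      simpa only [Submodule.mem_toAddSubgroup, Submodule.mem_torsionBy_iff] using hP'
    · intro P Q hPQ
      have h := congrArg (fun R : geomTorsion W ((p : ℤ) ^ d) => (R : geomPoints W)) hPQ
      exact Subtype.ext (Subtype.ext h)
  have hprod : Nat.card f.range * Nat.card f.ker = p ^ (2 * (d + 1)) := by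
    rw [← natCard_geomTorsion_pow W p (d + 1), ← Nat.card_congr (QuotientAddGroup.quotientKerEquivRange f).toEquiv]
    exact (AddSubgroup.card_eq_card_quotient_mul_card_addSubgroup f.ker).symm
  have hEp := Literature.NumberTheory.EllipticCurves.Rank1Residual.natCard_geomTorsion W p
  have hrange_le : Nat.card f.range ≤ p ^ 2 := hEp ▸ AddSubgroup.card_le_card_addGroup f.range
  have hrange : Nat.card f.range = p ^ 2 := by
    by_contra hne
    have hlt : Nat.card f.range < p ^ 2 := lt_of_le_of_ne hrange_le hne
    have h1 : Nat.card f.range * Nat.card f.ker < p ^ 2 * p ^ (2 * d) := by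
      calc Nat.card f.range * Nat.card f.ker ≤ Nat.card f.range * p ^ (2 * d) := Nat.mul_le_mul_left _ hker
        _ < p ^ 2 * p ^ (2 * d) := Nat.mul_lt_mul_of_pos_right hlt (pow_pos hp.pos _)
    rw [hprod, ← pow_add, show 2 + 2 * d = 2 * (d + 1) by ring] at h1
    exact lt_irrefl _ h1
  have htop : f.range = ⊤ := AddSubgroup.eq_top_of_card_eq f.range (by rw [hrange, hEp])
  exact AddMonoidHom.range_eq_top.mp htop

variable {W p d}

omit [W.IsElliptic] [Fact p.Prime] in
/-- If `ι : E[p] → E[p^{d+1}]` induces the inclusion of points and `p^d P' = Q` in `E[p]`, then `p^d • P' = ι Q` in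
`E[p^{d+1}]`. [cite: SilvermanAEC2009, III.§8 (Prop. 8.1)] -/
theorem nsmul_eq_of_geomTorsionPowToModP_eq (ι' : geomTorsion W (p : ℤ) →+ geomTorsion W ((p : ℤ) ^ (d + 1)))
    (hι' : ∀ Q : geomTorsion W (p : ℤ), ((ι' Q : geomTorsion W ((p : ℤ) ^ (d + 1))) : geomPoints W) = Q)
    {P' : geomTorsion W ((p : ℤ) ^ (d + 1))} {Q : geomTorsion W (p : ℤ)} (h : W.geomTorsionPowToModP p d P' = Q) :
    p ^ d • P' = ι' Q := by
  apply Subtype.ext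
  rw [hι', ← h, coe_geomTorsionPowToModP, AddSubmonoidClass.coe_nsmul, ← natCast_zsmul, Nat.cast_pow]

/-! ## §2 Descent of `(P, Q) ↦ e_k(P, ιQ)` through `P ↦ p^d P` -/

section Descent

variable {Pk : Type*} [AddCommGroup Pk]
  (ek : geomTorsion W ((p : ℤ) ^ (d + 1)) →+ geomTorsion W ((p : ℤ) ^ (d + 1)) →+ Pk)
  (ι' : geomTorsion W (p : ℤ) →+ geomTorsion W ((p : ℤ) ^ (d + 1)))
  (hι' : ∀ Q : geomTorsion W (p : ℤ), ((ι' Q : geomTorsion W ((p : ℤ) ^ (d + 1))) : geomPoints W) = Q)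

include hι' in
/-- **`e_k(P, ιQ) = 0` whenever `p^d P = 0`**: write `ιQ = p^d P'` (surjectivity of `p^d`) and move `p^d` across.
[cite: SilvermanAEC2009, III.§8 (Prop. 8.1 (a),(e))] -/
theorem apply_eq_zero_of_geomTorsionPowToModP_eq_zero {P : geomTorsion W ((p : ℤ) ^ (d + 1))}
    (hP : W.geomTorsionPowToModP p d P = 0) (Q : geomTorsion W (p : ℤ)) : ek P (ι' Q) = 0 := by
  obtain ⟨P', hP'⟩ := surjective_geomTorsionPowToModP W p d Q
  rw [← nsmul_eq_of_geomTorsionPowToModP_eq ι' hι' hP', map_nsmul, ← AddMonoidHom.nsmul_apply, ← map_nsmul]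
  have h0 : p ^ d • P = 0 := by
    apply Subtype.ext
    have h := congrArg (fun R : geomTorsion W (p : ℤ) => (R : geomPoints W)) hP
    simp only [coe_geomTorsionPowToModP, ZeroMemClass.coe_zero] at h
    rw [AddSubmonoidClass.coe_nsmul, ← natCast_zsmul, Nat.cast_pow, h, ZeroMemClass.coe_zero]
  rw [h0, map_zero, AddMonoidHom.zero_apply]

omit [W.IsElliptic] [Fact p.Prime] in
/-- `ι Q` is `p`-torsion, so `e_k(P, ιQ)` is killed by `p`. [cite: SilvermanAEC2009, III.§8 (Prop. 8.1 (a))] -/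
theorem nsmul_apply_apply_eq_zero (P : geomTorsion W ((p : ℤ) ^ (d + 1))) (Q : geomTorsion W (p : ℤ)) :
    p • ek P (ι' Q) = 0 := by
  rw [← map_nsmul, show p • ι' Q = 0 from ?_, map_zero]
  rw [← map_nsmul, AddSubgroup.torsionBy.nsmul Q, map_zero]

end Descent

section DescentMu

variable (ek : geomTorsion W ((p : ℤ) ^ (d + 1)) →+ geomTorsion W ((p : ℤ) ^ (d + 1)) →+ MuCarrier ℚ (p ^ (d + 1)))
  (ι' : geomTorsion W (p : ℤ) →+ geomTorsion W ((p : ℤ) ^ (d + 1)))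
  (hι' : ∀ Q : geomTorsion W (p : ℤ), ((ι' Q : geomTorsion W ((p : ℤ) ^ (d + 1))) : geomPoints W) = Q)

omit [Fact p.Prime] in
/-- `p ∣ p^{d+1}`. [folklore] -/
theorem dvd_pow_succ_self : p ∣ p ^ (d + 1) := dvd_pow_self p (Nat.succ_ne_zero d)

omit [Fact p.Prime] in
/-- `muInclusion : μ_p → μ_{p^{d+1}}` is injective. [folklore] -/
theorem muInclusion_injective : Function.Injective (muInclusion ℚ (dvd_pow_succ_self (p := p) (d := d))) := by
  intro v w h
  apply muVal_injective ℚ p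
  rw [← muVal_muInclusion ℚ (dvd_pow_succ_self (p := p) (d := d)) v, h, muVal_muInclusion]

omit [Fact p.Prime] in
/-- A `p`-torsion element of `μ_{p^{d+1}}` is in the image of `μ_p` (the tree's `μ_n[p] ≃ μ_p`). [folklore] -/
theorem exists_muInclusion_eq_of_nsmul_eq_zero {x : MuCarrier ℚ (p ^ (d + 1))} (hx : p • x = 0) :
    ∃ v : MuCarrier ℚ p, muInclusion ℚ (dvd_pow_succ_self (p := p) (d := d)) v = x := by
  have hx' : x ∈ Submodule.torsionBy ℤ (MuCarrier ℚ (p ^ (d + 1))) (p : ℤ) := by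
    rw [Submodule.mem_torsionBy_iff, natCast_zsmul]
    exact hx
  refine ⟨muTorsionEquiv ℚ p (dvd_pow_succ_self (p := p) (d := d)) ⟨x, hx'⟩, muVal_injective ℚ (p ^ (d + 1)) ?_⟩
  rw [muVal_muInclusion, muVal_muTorsionEquiv]

include hι' in
/-- **The descent**: there is a biadditive `ē : E[p] × E[p] → μ_p` with `e_k(P, ιQ) = incl(ē(p^d P, Q))` for all
`P ∈ E[p^{d+1}]`, `Q ∈ E[p]`; it is alternating if `e_k` is and right-non-degenerate if `e_k` is (and `ι` induces the
inclusion of points). [cite: SilvermanAEC2009, III.§8 (Prop. 8.1 (a),(c),(e))] -/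
theorem exists_descent (halt : ∀ T, ek T T = 0) (hnd : ∀ T, (∀ S, ek S T = 0) → T = 0) :
    ∃ ē : geomTorsion W (p : ℤ) →+ geomTorsion W (p : ℤ) →+ MuCarrier ℚ p,
      (∀ (P : geomTorsion W ((p : ℤ) ^ (d + 1))) (Q : geomTorsion W (p : ℤ)),
        ek P (ι' Q) = muInclusion ℚ (dvd_pow_succ_self (p := p) (d := d)) (ē (W.geomTorsionPowToModP p d P) Q)) ∧
      (∀ T, ē T T = 0) ∧ (∀ T, (∀ S, ē S T = 0) → T = 0) := by
  set red := W.geomTorsionPowToModP p d with hred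
  set j := muInclusion ℚ (dvd_pow_succ_self (p := p) (d := d)) with hj
  have hsurj := surjective_geomTorsionPowToModP W p d
  set L : geomTorsion W (p : ℤ) → geomTorsion W ((p : ℤ) ^ (d + 1)) := fun A => Classical.choose (hsurj A) with hL
  have hLred : ∀ A, red (L A) = A := fun A => Classical.choose_spec (hsurj A)
  have hval : ∀ (A Q : geomTorsion W (p : ℤ)), ∃ v : MuCarrier ℚ p, j v = ek (L A) (ι' Q) := fun A Q =>
    exists_muInclusion_eq_of_nsmul_eq_zero (nsmul_apply_apply_eq_zero ek ι' (L A) Q)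
  set g : geomTorsion W (p : ℤ) → geomTorsion W (p : ℤ) → MuCarrier ℚ p :=
    fun A Q => Classical.choose (hval A Q) with hg
  have hgj : ∀ A Q, j (g A Q) = ek (L A) (ι' Q) := fun A Q => Classical.choose_spec (hval A Q)
  have hindep : ∀ (P : geomTorsion W ((p : ℤ) ^ (d + 1))) (Q : geomTorsion W (p : ℤ)),
      ek P (ι' Q) = ek (L (red P)) (ι' Q) := by
    intro P Q
    rw [← sub_eq_zero, ← AddMonoidHom.sub_apply, ← map_sub]
    exact apply_eq_zero_of_geomTorsionPowToModP_eq_zero ek ι' hι' (by rw [map_sub, hLred, sub_self]) Q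
  have hinj := muInclusion_injective (p := p) (d := d)
  refine ⟨AddMonoidHom.mk' (fun A => AddMonoidHom.mk' (g A) fun Q₁ Q₂ => hinj ?_) fun A B => ?_, ?_, ?_, ?_⟩
  · rw [map_add, hgj, hgj, hgj, map_add, map_add]
  · ext Q
    simp only [AddMonoidHom.mk'_apply, AddMonoidHom.add_apply]
    apply hinj
    rw [map_add, hgj, hgj, hgj, ← AddMonoidHom.add_apply, ← map_add, hindep (L A + L B), map_add, hLred,
      hLred]
  · intro P Q
    simp only [AddMonoidHom.mk'_apply]
    rw [hgj, ← hindep]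
  · intro T
    simp only [AddMonoidHom.mk'_apply]
    apply hinj
    rw [hgj, map_zero, ← nsmul_eq_of_geomTorsionPowToModP_eq ι' hι' (hLred T), map_nsmul, halt, smul_zero]
  · intro T hT
    have hιT : ι' T = 0 := hnd (ι' T) fun S => by
      rw [hindep, ← hgj]
      have := hT (red S)
      simp only [AddMonoidHom.mk'_apply] at this
      rw [this, map_zero]
    apply Subtype.ext
    rw [← hι' T, hιT, ZeroMemClass.coe_zero, ZeroMemClass.coe_zero]

end DescentMu

/-! ## §3 Alternating pairings on `E[p]` are proportional -/

section Alternating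

variable {P₁ : Type*} [AddCommGroup P₁] (e₁ ē : geomTorsion W (p : ℤ) →+ geomTorsion W (p : ℤ) →+ P₁)

omit [W.IsElliptic] [Fact p.Prime] in
/-- An alternating biadditive pairing is skew: `F(A, B) = −F(B, A)`. [folklore] -/
theorem apply_eq_neg_of_alternating (halt : ∀ T, ē T T = 0) (A B : geomTorsion W (p : ℤ)) :
    ē A B = -ē B A := by
  have h := halt (A + B)
  rw [map_add, map_add, AddMonoidHom.add_apply, AddMonoidHom.add_apply, halt, halt, zero_add, add_zero] at h
  exact eq_neg_of_add_eq_zero_right h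

/-- **Two points pairing non-trivially under an alternating pairing generate `E[p]`** (order `p²`: the subgroup
they generate strictly contains `⟨Q₀⟩` of order `p`). [cite: SilvermanAEC2009, Cor. III.6.4(b)] -/
theorem closure_pair_eq_top (halt : ∀ T, e₁ T T = 0) {P₀ Q₀ : geomTorsion W (p : ℤ)} (h : e₁ P₀ Q₀ ≠ 0) :
    AddSubgroup.closure ({P₀, Q₀} : Set (geomTorsion W (p : ℤ))) = ⊤ := by
  have hp : p.Prime := Fact.out
  haveI := finite_geomTorsion_prime W p
  have hcard := Literature.NumberTheory.EllipticCurves.Rank1Residual.natCard_geomTorsion W p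
  have hQ₀H : Q₀ ∈ AddSubgroup.closure ({P₀, Q₀} : Set (geomTorsion W (p : ℤ))) :=
    AddSubgroup.subset_closure (by simp)
  have hP₀H : P₀ ∈ AddSubgroup.closure ({P₀, Q₀} : Set (geomTorsion W (p : ℤ))) :=
    AddSubgroup.subset_closure (by simp)
  have hQ₀ne : Q₀ ≠ 0 := by
    rintro rfl
    exact h (map_zero _)
  have hordQ₀ : addOrderOf Q₀ = p := addOrderOf_eq_prime (AddSubgroup.torsionBy.nsmul Q₀) hQ₀ne
  have hZ : Nat.card (AddSubgroup.zmultiples Q₀) = p := by rw [Nat.card_zmultiples, hordQ₀]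
  have hP₀notin : P₀ ∉ AddSubgroup.zmultiples Q₀ := by
    intro hmem
    obtain ⟨m, hm⟩ := AddSubgroup.mem_zmultiples_iff.mp hmem
    apply h
    rw [← hm, map_zsmul, AddMonoidHom.smul_apply, halt, smul_zero]
  have hle : AddSubgroup.zmultiples Q₀ ≤ AddSubgroup.closure ({P₀, Q₀} : Set (geomTorsion W (p : ℤ))) :=
    AddSubgroup.zmultiples_le_of_mem hQ₀H
  have hdvd : Nat.card (AddSubgroup.closure ({P₀, Q₀} : Set (geomTorsion W (p : ℤ)))) ∣ p ^ 2 := by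
    rw [← hcard]
    exact AddSubgroup.card_addSubgroup_dvd_card _
  have hpdvd : p ∣ Nat.card (AddSubgroup.closure ({P₀, Q₀} : Set (geomTorsion W (p : ℤ)))) := by
    have hd := AddSubgroup.card_dvd_of_le hle
    rwa [hZ] at hd
  have hne : Nat.card (AddSubgroup.closure ({P₀, Q₀} : Set (geomTorsion W (p : ℤ)))) ≠ p := fun hHp =>
    hP₀notin ((AddSubgroup.eq_of_le_of_card_ge hle (by rw [hHp, hZ])).symm ▸ hP₀H)
  obtain ⟨i, hi, hHi⟩ := (Nat.dvd_prime_pow hp).mp hdvd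
  have hi0 : i ≠ 0 := by
    rintro rfl
    rw [hHi, pow_zero, Nat.dvd_one] at hpdvd
    exact hp.one_lt.ne' hpdvd
  have hi1 : i ≠ 1 := by
    rintro rfl
    exact hne (hHi.trans (pow_one p))
  rw [show i = 2 by omega] at hHi
  exact AddSubgroup.eq_top_of_card_eq _ (by rw [hHi, hcard])

/-- **An alternating biadditive pairing on `E[p]` is determined by one value**: if `e₁, ē` are alternating,
`e₁ P₀ Q₀ ≠ 0` and `ē P₀ Q₀ = c • e₁ P₀ Q₀`, then `ē = c • e₁` (`P₀, Q₀` generate `E[p]`).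
[cite: SilvermanAEC2009, III.§8 (Prop. 8.1)] -/
theorem eq_zsmul_of_apply_eq_zsmul (halt₁ : ∀ T, e₁ T T = 0) (halt : ∀ T, ē T T = 0)
    {P₀ Q₀ : geomTorsion W (p : ℤ)} (h : e₁ P₀ Q₀ ≠ 0) {c : ℤ} (hc : ē P₀ Q₀ = c • e₁ P₀ Q₀) :
    ē = c • e₁ := by
  set F := ē - c • e₁ with hF
  have hFalt : ∀ T, F T T = 0 := fun T => by
    simp only [hF, AddMonoidHom.sub_apply, AddMonoidHom.smul_apply, halt, halt₁, smul_zero, sub_self]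
  have hF0 : F P₀ Q₀ = 0 := by
    simp only [hF, AddMonoidHom.sub_apply, AddMonoidHom.smul_apply, hc, sub_self]
  have hF0' : F Q₀ P₀ = 0 := by rw [apply_eq_neg_of_alternating (p := p) F hFalt, hF0, neg_zero]
  have htop := closure_pair_eq_top (p := p) e₁ halt₁ h
  have hgen : ∀ A : geomTorsion W (p : ℤ), (F A P₀ = 0 ∧ F A Q₀ = 0) → ∀ B, F A B = 0 := by
    intro A hA B
    have hB : B ∈ AddSubgroup.closure ({P₀, Q₀} : Set (geomTorsion W (p : ℤ))) := by rw [htop]; trivial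
    induction hB using AddSubgroup.closure_induction with
    | mem x hx =>
      rcases hx with rfl | hx
      · exact hA.1
      · exact (Set.mem_singleton_iff.mp hx) ▸ hA.2
    | zero => exact map_zero _
    | add x y _ _ hx hy => rw [map_add, hx, hy, add_zero]
    | neg x _ hx => rw [map_neg, hx, neg_zero]
  have hall : ∀ A B : geomTorsion W (p : ℤ), F A B = 0 := by
    intro A
    have hA : A ∈ AddSubgroup.closure ({P₀, Q₀} : Set (geomTorsion W (p : ℤ))) := by rw [htop]; trivial
    induction hA using AddSubgroup.closure_induction with
    | mem x hx =>
      rcases hx with rfl | hx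
      · exact hgen _ ⟨hFalt _, hF0⟩
      · exact (Set.mem_singleton_iff.mp hx).symm ▸ hgen _ ⟨hF0', hFalt _⟩
    | zero => intro B; rw [map_zero, AddMonoidHom.zero_apply]
    | add x y _ _ hx hy => intro B; rw [map_add, AddMonoidHom.add_apply, hx, hy, add_zero]
    | neg x _ hx => intro B; rw [map_neg, AddMonoidHom.neg_apply, hx, neg_zero]
  have hF00 : F = 0 := AddMonoidHom.ext fun A => AddMonoidHom.ext fun B => hall A B
  rw [hF, sub_eq_zero] at hF00
  exact hF00

end Alternating

section AlternatingMu

variable (e₁ ē : geomTorsion W (p : ℤ) →+ geomTorsion W (p : ℤ) →+ MuCarrier ℚ p)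

omit [Fact p.Prime] in
/-- `μ_p` (additively) is killed by `p`. [folklore] -/
theorem nsmul_muCarrier_eq_zero (ζ : MuCarrier ℚ p) : p • ζ = 0 :=
  muVal_injective ℚ p (by rw [muVal_nsmul, muVal_pow_eq_one, muVal_zero])

/-- In `μ_p` every element is an integer multiple of any non-zero element. [folklore] -/
theorem exists_int_eq_zsmul_muCarrier {w : MuCarrier ℚ p} (hw : w ≠ 0) (v : MuCarrier ℚ p) :
    ∃ c : ℤ, v = c • w := by
  haveI : NeZero p := ⟨(Fact.out : p.Prime).ne_zero⟩
  set φ := muEquivZMod ℚ p with hφ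
  have ha : φ w ≠ 0 := fun h0 => hw (φ.map_eq_zero_iff.mp h0)
  refine ⟨((φ v * (φ w)⁻¹ : ZMod p).val : ℤ), φ.injective ?_⟩
  rw [map_zsmul, natCast_zsmul, nsmul_eq_mul, ZMod.natCast_zmod_val, inv_mul_cancel_right₀ ha]

/-- **Two alternating biadditive `μ_p`-valued pairings on `E[p]`, the first right-non-degenerate, are proportional:
`ē = c • e₁`; if `ē` is right-non-degenerate too then `p ∤ c`.** [cite: SilvermanAEC2009, III.§8 (Prop. 8.1)] -/
theorem exists_int_not_dvd_eq_zsmul_of_alternating (halt₁ : ∀ T, e₁ T T = 0)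
    (hnd₁ : ∀ T, (∀ S, e₁ S T = 0) → T = 0) (halt : ∀ T, ē T T = 0) (hnd : ∀ T, (∀ S, ē S T = 0) → T = 0) :
    ∃ c : ℤ, ¬ ((p : ℤ) ∣ c) ∧ ē = c • e₁ := by
  have hp : p.Prime := Fact.out
  haveI := finite_geomTorsion_prime W p
  have hcard := Literature.NumberTheory.EllipticCurves.Rank1Residual.natCard_geomTorsion W p
  have hnt : Nontrivial (geomTorsion W (p : ℤ)) := by
    rw [← Finite.one_lt_card_iff_nontrivial, hcard]
    exact Nat.one_lt_pow two_ne_zero hp.one_lt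
  obtain ⟨Q₀, hQ₀⟩ := exists_ne (0 : geomTorsion W (p : ℤ))
  have hex : ∃ P₀, e₁ P₀ Q₀ ≠ 0 := by
    by_contra hno
    push Not at hno
    exact hQ₀ (hnd₁ Q₀ hno)
  obtain ⟨P₀, hP₀⟩ := hex
  obtain ⟨c, hc⟩ := exists_int_eq_zsmul_muCarrier (p := p) hP₀ (ē P₀ Q₀)
  have hē := eq_zsmul_of_apply_eq_zsmul (p := p) e₁ ē halt₁ halt hP₀ hc
  refine ⟨c, fun hpc => ?_, hē⟩
  obtain ⟨c', rfl⟩ := hpc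
  apply hQ₀
  refine hnd Q₀ fun S => ?_
  rw [hē, AddMonoidHom.smul_apply, AddMonoidHom.smul_apply, mul_comm, mul_smul, natCast_zsmul,
    nsmul_muCarrier_eq_zero, smul_zero]

end AlternatingMu

/-! ## §4 The bridge -/

/-- **The pairing bridge `E[p^{d+1}] × E[p] → μ_{p^{d+1}}`.**  For an alternating right-non-degenerate biadditive
`μ_{p^{d+1}}`-valued pairing `e_k` on `E[p^{d+1}]`, an alternating right-non-degenerate biadditive `μ_p`-valued pairing
`e₁` on `E[p]`, and an additive `ι : E[p] → E[p^{d+1}]` inducing the inclusion of points, there is `c ∈ ℤ` with `p ∤ c`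
and `e_k(P, ιQ) = incl(c • e₁(p^d P, Q))` for all `P ∈ E[p^{d+1}]`, `Q ∈ E[p]` (`incl = muInclusion : μ_p ⊂ μ_{p^{d+1}}`).
With the Weil pairings this is Silverman III.8.1 (e) up to the unit `c`. [cite: SilvermanAEC2009, III.§8 (Prop. 8.1 (e))] -/
theorem exists_unit_descent
    (ek : geomTorsion W ((p : ℤ) ^ (d + 1)) →+ geomTorsion W ((p : ℤ) ^ (d + 1)) →+ MuCarrier ℚ (p ^ (d + 1)))
    (halt : ∀ T, ek T T = 0) (hnd : ∀ T, (∀ S, ek S T = 0) → T = 0)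
    (e₁ : geomTorsion W (p : ℤ) →+ geomTorsion W (p : ℤ) →+ MuCarrier ℚ p)
    (halt₁ : ∀ T, e₁ T T = 0) (hnd₁ : ∀ T, (∀ S, e₁ S T = 0) → T = 0)
    (ι' : geomTorsion W (p : ℤ) →+ geomTorsion W ((p : ℤ) ^ (d + 1)))
    (hι' : ∀ Q : geomTorsion W (p : ℤ), ((ι' Q : geomTorsion W ((p : ℤ) ^ (d + 1))) : geomPoints W) = Q) :
    ∃ c : ℤ, ¬ ((p : ℤ) ∣ c) ∧ ∀ (P : geomTorsion W ((p : ℤ) ^ (d + 1))) (Q : geomTorsion W (p : ℤ)),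
      ek P (ι' Q) = muInclusion ℚ (dvd_pow_succ_self (p := p) (d := d)) (c • e₁ (W.geomTorsionPowToModP p d P) Q) := by
  obtain ⟨ē, hē, hēalt, hēnd⟩ := exists_descent ek ι' hι' halt hnd
  obtain ⟨c, hc, hēc⟩ := exists_int_not_dvd_eq_zsmul_of_alternating e₁ ē halt₁ hnd₁ hēalt hēnd
  refine ⟨c, hc, fun P Q => ?_⟩
  rw [hē, hēc, AddMonoidHom.smul_apply, AddMonoidHom.smul_apply]

end Summit.BirchSwinnertonDyer.BirchSwinnertonDyer.Theorems.OneSidedTwistSqueezeX9KatoDivisibilityX9StubReciprocityPkX9Pairing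

end
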